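import Mathlib
import Summits.KontsevichZagierPeriods.Zeta5Search.LevelClassDigits
import Summits.KontsevichZagierPeriods.Zeta5Search.TypeEval
import Summits.KontsevichZagierPeriods.Zeta5Search.ClusterValuationResidues
import HarnessLib

/-!
# ζ(5) search — KUMMER AT OCTAVE ONE: the digit-vanishing unit of two-level classes at `p = 7` (and `p = 11`)

Cell `pub-zeta5`, track DENOM-LAW (D1 prover, denom-prover-d1 g4; lead brief INBOX l.7802 item (3), theory-d1 g6
`WEDGE-OCTAVE-CONSTANTS.md` §0(b), engine-d2 C-D2-20 octave 1).  HONEST FRAMING: systematic search; `p`-adic valuations of the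
cell's own partial-fraction class sums `V_x`, `W_x` (rational numbers); MODEL-side worth on the census rays = 0 (the phenomenon lives at
ONE prime per type); nothing about ζ(5); no irrationality claim; records in print UNMOVED.

THE FACT.  A centre-free LEVEL CLASS with two levels (`x < p ≤ x + p ≤ b₀ < x + 2p`) and type `T = (e₀, e₁)` has first digits
`v̂(T)`, `ŵ(T)` (tree: `LevelClassDigits.v_digit_level / w_digit_level`, `V_x = (−p)^{E}(ĝ_x v̂(T) + O(p))`,
`W_x = (−p)^{E+3}(ĝ_x ŵ(T) + O(p))`).  For a full pole at one level these digits are BINOMIAL COEFFICIENTS: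
`v̂(−a, −6) = C(a+5, 5)`, `v̂(−6, −a) = (−1)^a C(a+5, 6)`, `ŵ(−a, −6) = C(a+2, 5) − C(a+2, 3) = (−1)^{a+1} ŵ(−6, −a)` — so by Kummer's carry
count they vanish mod `7` exactly for `a ≥ 2` (`v̂`: 21, 56, 126, 252, 462; 7, 28, 84, 210, 462) resp. `a ∈ {4, 5}` (`ŵ = ±14`), and
`v̂(−6,−6) = 462` vanishes mod `11` as well.  Consequently (theorems below, all `b` in the polytope, window `p² > b₀ + 2`):
* `kummer7_classV_lower` / `kummer7_classV_upper`: at `p = 7`, `v₇(V_x) ≥ E_x + 1` for every centre-free two-level class of type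
  `(−a, −6)` or `(−6, −a)`, `2 ≤ a ≤ 6` (generic: `E_x`, `ClusterValuation.classExpBound`);
* `kummer7_classW_lower` / `kummer7_classW_upper`: at `p = 7`, `v₇(W_x) ≥ E_x + 4` for types `(−4,−6), (−5,−6), (−6,−4), (−6,−5)` (generic `E_x + 3`);
* `kummer11_classV`: at `p = 11`, `v₁₁(V_x) ≥ E_x + 1` for type `(−6, −6)`.
This is the class-level mechanism behind engine-d2's octave-1 entry `(m, p) = (1, 7)` of the D-region firing table (C-D2-20: `v₇(V) =
VB⁺ + 1` on D(1) cells) as read by theory-d1 g6 (`7 ‖ v̂₁ = 21`, `7 ‖ ŵ₁ = −14`): a digit ACCIDENT of one prime, not a rung.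
The general wrappers `val_classV_of_digit` / `val_classW_of_digit` (any `p`, any level class: `p ∣ v̂(T)` ⇒ `+1` on `V_x`;
`p ∣ ŵ(T)` ⇒ `+1` on `W_x`) are the reusable part.  The CENTRE class of the symmetric cells `b₀ = 2x + p` (the one two-level
configuration outside the level lemmas; `ŵ = −14`, `v̂ = 21`) is `DenomLaw/KummerOctaveOneCentre.lean`.
-/

noncomputable section

open Finset

namespace Summit.KontsevichZagierPeriods.Zeta5Search.KummerOctaveOne

open Summit.KontsevichZagierPeriods.Zeta5Search.CasoratianValuation (InPolytope)
open Summit.KontsevichZagierPeriods.Zeta5Search.ClusterValuation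
open Summit.KontsevichZagierPeriods.Zeta5Search.CellA (classW small_add small_mul)
open Summit.KontsevichZagierPeriods.Zeta5Search.LevelClass
open Summit.KontsevichZagierPeriods.Zeta5Search.TypeEval (typeRho_eq_typeRhoC)

variable {p : ℕ} [hp : Fact p.Prime]

/-! ## §1 Digit divisible by `p` ⇒ one extra unit (any `p`, any centre-free level class) -/

section Wrapper

variable (b : ℕ → ℤ) {x L : ℕ} (hx : x < p) (hL : x + L * p ≤ (b 0).toNat) (hL' : (b 0).toNat < x + L * p + p)

include hx hL hL' in
/-- **`p ∣ v̂(T)` ⇒ `v_p(V_x) ≥ E(T) + 1`.**  (`v_digit_level` with `g = ĝ_x`, `‖ĝ_x‖ ≤ 1`, ultrametric inequality.) -/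
theorem val_classV_of_digit (hb : InPolytope b) (hp5 : 5 ≤ p) (hwin : (b 0 + 2 : ℤ) < (p : ℤ) ^ 2) (e : ℕ → ℤ)
    (he : ∀ k ≤ L, netExp b (x + k * p) = e k) (hc : ¬ CentreIn b p x) {i₀ : ℕ} (hi₀ : i₀ ≤ L) (hneg : e i₀ < 0)
    (hdig : padicNorm p (typeV L e) ≤ (p : ℚ) ^ (-(1 : ℤ))) (hne : classV b p x ≠ 0) :
    typeExp L e + 1 ≤ padicValRat p (classV b p x) := by
  have hp' : (-(p : ℚ)) ≠ 0 := neg_ne_zero.2 (Nat.cast_ne_zero.2 hp.out.ne_zero)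
  have hx0 : x ∈ classSet b p x := by simpa using level_mem b hx hL hL' (Nat.zero_le L)
  have hg1 : padicNorm p (gHat b p x) ≤ 1 := padicNorm_gHat_le_one b hb hp5 hx hx0
  have h := v_digit_level b hx hL hL' hb hp5 hwin e he hc hi₀ hneg (g := gHat b p x)
    (by rw [sub_self, padicNorm.zero]; positivity)
  have h2 : padicNorm p ((-(p : ℚ)) ^ (-typeExp L e) * classV b p x) ≤ (p : ℚ) ^ (-(1 : ℤ)) := by
    have e1 : (-(p : ℚ)) ^ (-typeExp L e) * classV b p x =
        ((-(p : ℚ)) ^ (-typeExp L e) * classV b p x - gHat b p x * typeV L e) + gHat b p x * typeV L e := by ring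
    rw [e1]
    exact small_add h (small_mul hg1 hdig)
  have hne' : (-(p : ℚ)) ^ (-typeExp L e) * classV b p x ≠ 0 := mul_ne_zero (zpow_ne_zero _ hp') hne
  have hv := val_ge_of_padicNorm_le hne' h2
  rw [padicValRat.mul (zpow_ne_zero _ hp') hne, padicValRat.zpow, padicValRat.neg, padicValRat.self hp.out.one_lt,
    mul_one] at hv
  linarith

include hx hL hL' in
/-- **`p ∣ ŵ(T)` ⇒ `v_p(W_x) ≥ E(T) + 4`** (`W_x = classW = Σ_{s ∈ class} c_{2,s}`; generic `E + 3`). -/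
theorem val_classW_of_digit (hb : InPolytope b) (hp5 : 5 ≤ p) (hwin : (b 0 + 2 : ℤ) < (p : ℤ) ^ 2) (e : ℕ → ℤ)
    (he : ∀ k ≤ L, netExp b (x + k * p) = e k) (hc : ¬ CentreIn b p x) {i₀ : ℕ} (hi₀ : i₀ ≤ L) (hneg : e i₀ < 0)
    (hdig : padicNorm p (typeW L e) ≤ (p : ℚ) ^ (-(1 : ℤ))) (hne : classW b p x ≠ 0) :
    typeExp L e + 4 ≤ padicValRat p (classW b p x) := by
  have hp' : (-(p : ℚ)) ≠ 0 := neg_ne_zero.2 (Nat.cast_ne_zero.2 hp.out.ne_zero)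
  have hx0 : x ∈ classSet b p x := by simpa using level_mem b hx hL hL' (Nat.zero_le L)
  have hg1 : padicNorm p (gHat b p x) ≤ 1 := padicNorm_gHat_le_one b hb hp5 hx hx0
  have h := w_digit_level b hx hL hL' hb hp5 hwin e he hc hi₀ hneg (g := gHat b p x)
    (by rw [sub_self, padicNorm.zero]; positivity)
  have h2 : padicNorm p ((-(p : ℚ)) ^ (-(typeExp L e + 3)) * classW b p x) ≤ (p : ℚ) ^ (-(1 : ℤ)) := by
    have e1 : (-(p : ℚ)) ^ (-(typeExp L e + 3)) * classW b p x =
        ((-(p : ℚ)) ^ (-(typeExp L e + 3)) * classW b p x - gHat b p x * typeW L e) + gHat b p x * typeW L e := by ring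
    rw [e1]
    exact small_add h (small_mul hg1 hdig)
  have hne' : (-(p : ℚ)) ^ (-(typeExp L e + 3)) * classW b p x ≠ 0 := mul_ne_zero (zpow_ne_zero _ hp') hne
  have hv := val_ge_of_padicNorm_le hne' h2
  rw [padicValRat.mul (zpow_ne_zero _ hp') hne, padicValRat.zpow, padicValRat.neg, padicValRat.self hp.out.one_lt,
    mul_one] at hv
  linarith

end Wrapper

/-! ## §2 The two-level types and their digits (exact rational identities, by the computable mirror `TypeEval`) -/

/-- The two-level type `(e₀, e₁)` as an exponent function on levels. -/
def lvl2 (e₀ e₁ : ℤ) : ℕ → ℤ := fun k => if k = 0 then e₀ else if k = 1 then e₁ else 0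

/-- `E(e₀, e₁) = e₀ + e₁`. -/
theorem typeExp_lvl2 (e₀ e₁ : ℤ) : typeExp 1 (lvl2 e₀ e₁) = e₀ + e₁ := by
  unfold typeExp lvl2
  rw [sum_range_succ, sum_range_one]
  simp

/-- `v̂(−2, −6) = C(7,5) = 21`. -/
theorem typeV_l2 : typeV 1 (lvl2 (-2) (-6)) = 21 := by
  unfold typeV lvl2; simp only [typeRho_eq_typeRhoC]; decide +kernel
/-- `v̂(−3, −6) = C(8,5) = 56`. -/
theorem typeV_l3 : typeV 1 (lvl2 (-3) (-6)) = 56 := by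
  unfold typeV lvl2; simp only [typeRho_eq_typeRhoC]; decide +kernel
/-- `v̂(−4, −6) = C(9,5) = 126`. -/
theorem typeV_l4 : typeV 1 (lvl2 (-4) (-6)) = 126 := by
  unfold typeV lvl2; simp only [typeRho_eq_typeRhoC]; decide +kernel
/-- `v̂(−5, −6) = C(10,5) = 252`. -/
theorem typeV_l5 : typeV 1 (lvl2 (-5) (-6)) = 252 := by
  unfold typeV lvl2; simp only [typeRho_eq_typeRhoC]; decide +kernel
/-- `v̂(−6, −6) = C(11,5) = 462 = 2·3·7·11`. -/
theorem typeV_l6 : typeV 1 (lvl2 (-6) (-6)) = 462 := by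
  unfold typeV lvl2; simp only [typeRho_eq_typeRhoC]; decide +kernel
/-- `v̂(−6, −2) = C(7,6) = 7`. -/
theorem typeV_u2 : typeV 1 (lvl2 (-6) (-2)) = 7 := by
  unfold typeV lvl2; simp only [typeRho_eq_typeRhoC]; decide +kernel
/-- `v̂(−6, −3) = −C(8,6) = −28`. -/
theorem typeV_u3 : typeV 1 (lvl2 (-6) (-3)) = -28 := by
  unfold typeV lvl2; simp only [typeRho_eq_typeRhoC]; decide +kernel
/-- `v̂(−6, −4) = C(9,6) = 84`. -/
theorem typeV_u4 : typeV 1 (lvl2 (-6) (-4)) = 84 := by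
  unfold typeV lvl2; simp only [typeRho_eq_typeRhoC]; decide +kernel
/-- `v̂(−6, −5) = −C(10,6) = −210`. -/
theorem typeV_u5 : typeV 1 (lvl2 (-6) (-5)) = -210 := by
  unfold typeV lvl2; simp only [typeRho_eq_typeRhoC]; decide +kernel
/-- `ŵ(−4, −6) = C(6,5) − C(6,3) = −14`. -/
theorem typeW_l4 : typeW 1 (lvl2 (-4) (-6)) = -14 := by
  unfold typeW lvl2; simp only [typeRho_eq_typeRhoC]; decide +kernel
/-- `ŵ(−5, −6) = C(7,5) − C(7,3) = −14`. -/
theorem typeW_l5 : typeW 1 (lvl2 (-5) (-6)) = -14 := by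
  unfold typeW lvl2; simp only [typeRho_eq_typeRhoC]; decide +kernel
/-- `ŵ(−6, −4) = 14`. -/
theorem typeW_u4 : typeW 1 (lvl2 (-6) (-4)) = 14 := by
  unfold typeW lvl2; simp only [typeRho_eq_typeRhoC]; decide +kernel
/-- `ŵ(−6, −5) = −14` (`E` odd: `ŵ(reverse T) = (−1)^{E+1} ŵ(T)`). -/
theorem typeW_u5 : typeW 1 (lvl2 (-6) (-5)) = -14 := by
  unfold typeW lvl2; simp only [typeRho_eq_typeRhoC]; decide +kernel

/-- `‖n‖_p ≤ p⁻¹` for an integer `n` divisible by `p`. -/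
theorem padicNorm_intCast_le_of_dvd {n : ℤ} (h : (p : ℤ) ∣ n) : padicNorm p (n : ℚ) ≤ (p : ℚ) ^ (-(1 : ℤ)) := by
  have h' : ((p ^ 1 : ℕ) : ℤ) ∣ n := by simpa using h
  have := padicNorm.dvd_iff_norm_le.1 h'
  simpa using this

/-! ## §3 Two-level classes: reading the type off the cell -/

section TwoLevel

variable (b : ℕ → ℤ) {x : ℕ} (hx : x < p) (h1 : x + p ≤ (b 0).toNat) (h1' : (b 0).toNat < x + p + p)

include h1 in
omit hp in
/-- `x + 1·p ≤ b₀` in the form the level lemmas want. -/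
theorem hL_two : x + 1 * p ≤ (b 0).toNat := by simpa using h1

include h1' in
omit hp in
/-- `b₀ < x + 1·p + p` in the form the level lemmas want. -/
theorem hL'_two : (b 0).toNat < x + 1 * p + p := by simpa using h1'

omit hp in
/-- The type hypothesis of a two-level class from the two net exponents. -/
theorem he_two {e₀ e₁ : ℤ} (h0 : netExp b x = e₀) (h1e : netExp b (x + p) = e₁) :
    ∀ k ≤ 1, netExp b (x + k * p) = lvl2 e₀ e₁ k := by
  intro k hk
  interval_cases k
  · simpa [lvl2] using h0
  · simpa [lvl2] using h1e

end TwoLevel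

/-! ## §4 Kummer at octave one: `p = 7` (and `p = 11`) -/

/-- **`p = 7`, type `(−a, −6)`, `2 ≤ a ≤ 6`: `v₇(V_x) ≥ E_x + 1 = −a − 5`** (generic bound `E_x = −a − 6`). -/
theorem kummer7_classV_lower (b : ℕ → ℤ) {x : ℕ} (a : ℕ) (ha : 2 ≤ a) (ha6 : a ≤ 6) (hb : InPolytope b)
    (hwin : (b 0 + 2 : ℤ) < (7 : ℤ) ^ 2) (hx : x < 7) (h1 : x + 7 ≤ (b 0).toNat) (h1' : (b 0).toNat < x + 7 + 7)
    (hc : ¬ CentreIn b 7 x) (he0 : netExp b x = -(a : ℤ)) (he1 : netExp b (x + 7) = -6) (hne : classV b 7 x ≠ 0) :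
    -(a : ℤ) - 6 + 1 ≤ padicValRat 7 (classV b 7 x) := by
  haveI : Fact (Nat.Prime 7) := ⟨by norm_num⟩
  have key : padicNorm 7 (typeV 1 (lvl2 (-(a : ℤ)) (-6))) ≤ (7 : ℚ) ^ (-(1 : ℤ)) := by
    interval_cases a
    · rw [show (-((2 : ℕ) : ℤ)) = -2 by norm_num, typeV_l2]; exact_mod_cast padicNorm_intCast_le_of_dvd (p := 7) (n := 21) (by norm_num)
    · rw [show (-((3 : ℕ) : ℤ)) = -3 by norm_num, typeV_l3]; exact_mod_cast padicNorm_intCast_le_of_dvd (p := 7) (n := 56) (by norm_num)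
    · rw [show (-((4 : ℕ) : ℤ)) = -4 by norm_num, typeV_l4]; exact_mod_cast padicNorm_intCast_le_of_dvd (p := 7) (n := 126) (by norm_num)
    · rw [show (-((5 : ℕ) : ℤ)) = -5 by norm_num, typeV_l5]; exact_mod_cast padicNorm_intCast_le_of_dvd (p := 7) (n := 252) (by norm_num)
    · rw [show (-((6 : ℕ) : ℤ)) = -6 by norm_num, typeV_l6]; exact_mod_cast padicNorm_intCast_le_of_dvd (p := 7) (n := 462) (by norm_num)
  have h := val_classV_of_digit (p := 7) b hx (hL_two b h1) (hL'_two b h1') hb (by norm_num) hwin (lvl2 (-(a : ℤ)) (-6))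
    (he_two b he0 he1) hc (i₀ := 1) le_rfl (by simp [lvl2]) key hne
  rw [typeExp_lvl2] at h
  linarith

/-- **`p = 7`, type `(−6, −a)`, `2 ≤ a ≤ 6`: `v₇(V_x) ≥ E_x + 1`.** -/
theorem kummer7_classV_upper (b : ℕ → ℤ) {x : ℕ} (a : ℕ) (ha : 2 ≤ a) (ha6 : a ≤ 6) (hb : InPolytope b)
    (hwin : (b 0 + 2 : ℤ) < (7 : ℤ) ^ 2) (hx : x < 7) (h1 : x + 7 ≤ (b 0).toNat) (h1' : (b 0).toNat < x + 7 + 7)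
    (hc : ¬ CentreIn b 7 x) (he0 : netExp b x = -6) (he1 : netExp b (x + 7) = -(a : ℤ)) (hne : classV b 7 x ≠ 0) :
    -6 - (a : ℤ) + 1 ≤ padicValRat 7 (classV b 7 x) := by
  haveI : Fact (Nat.Prime 7) := ⟨by norm_num⟩
  have key : padicNorm 7 (typeV 1 (lvl2 (-6) (-(a : ℤ)))) ≤ (7 : ℚ) ^ (-(1 : ℤ)) := by
    interval_cases a
    · rw [show (-((2 : ℕ) : ℤ)) = -2 by norm_num, typeV_u2]; exact_mod_cast padicNorm_intCast_le_of_dvd (p := 7) (n := 7) (by norm_num)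
    · rw [show (-((3 : ℕ) : ℤ)) = -3 by norm_num, typeV_u3]; exact_mod_cast padicNorm_intCast_le_of_dvd (p := 7) (n := -28) (by norm_num)
    · rw [show (-((4 : ℕ) : ℤ)) = -4 by norm_num, typeV_u4]; exact_mod_cast padicNorm_intCast_le_of_dvd (p := 7) (n := 84) (by norm_num)
    · rw [show (-((5 : ℕ) : ℤ)) = -5 by norm_num, typeV_u5]; exact_mod_cast padicNorm_intCast_le_of_dvd (p := 7) (n := -210) (by norm_num)
    · rw [show (-((6 : ℕ) : ℤ)) = -6 by norm_num, typeV_l6]; exact_mod_cast padicNorm_intCast_le_of_dvd (p := 7) (n := 462) (by norm_num)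
  have h := val_classV_of_digit (p := 7) b hx (hL_two b h1) (hL'_two b h1') hb (by norm_num) hwin (lvl2 (-6) (-(a : ℤ)))
    (he_two b he0 he1) hc (i₀ := 0) (by norm_num) (by simp [lvl2]) key hne
  rw [typeExp_lvl2] at h
  linarith

/-- **`p = 7`, types `(−4,−6)`, `(−5,−6)`: `v₇(W_x) ≥ E_x + 4`** (generic `E_x + 3`). -/
theorem kummer7_classW_lower (b : ℕ → ℤ) {x : ℕ} (a : ℕ) (ha : 4 ≤ a) (ha5 : a ≤ 5) (hb : InPolytope b)
    (hwin : (b 0 + 2 : ℤ) < (7 : ℤ) ^ 2) (hx : x < 7) (h1 : x + 7 ≤ (b 0).toNat) (h1' : (b 0).toNat < x + 7 + 7)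
    (hc : ¬ CentreIn b 7 x) (he0 : netExp b x = -(a : ℤ)) (he1 : netExp b (x + 7) = -6) (hne : classW b 7 x ≠ 0) :
    -(a : ℤ) - 6 + 4 ≤ padicValRat 7 (classW b 7 x) := by
  haveI : Fact (Nat.Prime 7) := ⟨by norm_num⟩
  have key : padicNorm 7 (typeW 1 (lvl2 (-(a : ℤ)) (-6))) ≤ (7 : ℚ) ^ (-(1 : ℤ)) := by
    interval_cases a
    · rw [show (-((4 : ℕ) : ℤ)) = -4 by norm_num, typeW_l4]; exact_mod_cast padicNorm_intCast_le_of_dvd (p := 7) (n := -14) (by norm_num)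
    · rw [show (-((5 : ℕ) : ℤ)) = -5 by norm_num, typeW_l5]; exact_mod_cast padicNorm_intCast_le_of_dvd (p := 7) (n := -14) (by norm_num)
  have h := val_classW_of_digit (p := 7) b hx (hL_two b h1) (hL'_two b h1') hb (by norm_num) hwin (lvl2 (-(a : ℤ)) (-6))
    (he_two b he0 he1) hc (i₀ := 1) le_rfl (by simp [lvl2]) key hne
  rw [typeExp_lvl2] at h
  linarith

/-- **`p = 7`, types `(−6,−4)`, `(−6,−5)`: `v₇(W_x) ≥ E_x + 4`.** -/
theorem kummer7_classW_upper (b : ℕ → ℤ) {x : ℕ} (a : ℕ) (ha : 4 ≤ a) (ha5 : a ≤ 5) (hb : InPolytope b)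
    (hwin : (b 0 + 2 : ℤ) < (7 : ℤ) ^ 2) (hx : x < 7) (h1 : x + 7 ≤ (b 0).toNat) (h1' : (b 0).toNat < x + 7 + 7)
    (hc : ¬ CentreIn b 7 x) (he0 : netExp b x = -6) (he1 : netExp b (x + 7) = -(a : ℤ)) (hne : classW b 7 x ≠ 0) :
    -6 - (a : ℤ) + 4 ≤ padicValRat 7 (classW b 7 x) := by
  haveI : Fact (Nat.Prime 7) := ⟨by norm_num⟩
  have key : padicNorm 7 (typeW 1 (lvl2 (-6) (-(a : ℤ)))) ≤ (7 : ℚ) ^ (-(1 : ℤ)) := by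
    interval_cases a
    · rw [show (-((4 : ℕ) : ℤ)) = -4 by norm_num, typeW_u4]; exact_mod_cast padicNorm_intCast_le_of_dvd (p := 7) (n := 14) (by norm_num)
    · rw [show (-((5 : ℕ) : ℤ)) = -5 by norm_num, typeW_u5]; exact_mod_cast padicNorm_intCast_le_of_dvd (p := 7) (n := -14) (by norm_num)
  have h := val_classW_of_digit (p := 7) b hx (hL_two b h1) (hL'_two b h1') hb (by norm_num) hwin (lvl2 (-6) (-(a : ℤ)))
    (he_two b he0 he1) hc (i₀ := 0) (by norm_num) (by simp [lvl2]) key hne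
  rw [typeExp_lvl2] at h
  linarith

/-- **`p = 11`, type `(−6, −6)`: `v₁₁(V_x) ≥ E_x + 1 = −11`** (`v̂ = 462 = 2·3·7·11`). -/
theorem kummer11_classV (b : ℕ → ℤ) {x : ℕ} (hb : InPolytope b) (hwin : (b 0 + 2 : ℤ) < (11 : ℤ) ^ 2) (hx : x < 11)
    (h1 : x + 11 ≤ (b 0).toNat) (h1' : (b 0).toNat < x + 11 + 11) (hc : ¬ CentreIn b 11 x) (he0 : netExp b x = -6)
    (he1 : netExp b (x + 11) = -6) (hne : classV b 11 x ≠ 0) : -11 ≤ padicValRat 11 (classV b 11 x) := by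
  haveI : Fact (Nat.Prime 11) := ⟨by norm_num⟩
  have key : padicNorm 11 (typeV 1 (lvl2 (-6) (-6))) ≤ (11 : ℚ) ^ (-(1 : ℤ)) := by
    rw [typeV_l6]; exact_mod_cast padicNorm_intCast_le_of_dvd (p := 11) (n := 462) (by norm_num)
  have h := val_classV_of_digit (p := 11) b hx (hL_two b h1) (hL'_two b h1') hb (by norm_num) hwin (lvl2 (-6) (-6))
    (he_two b he0 he1) hc (i₀ := 0) (by norm_num) (by simp [lvl2]) key hne
  rw [typeExp_lvl2] at h
  linarith


end Summit.KontsevichZagierPeriods.Zeta5Search.KummerOctaveOne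

end
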